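import Mathlib
import HarnessLib
import Summits.ResolutionOfSingularities.ResolutionOfSingularities.Theorems.HomologicalConductorPersistenceLostAssembly
import Summits.ResolutionOfSingularities.ResolutionOfSingularities.Theorems.HomologicalConductorPersistenceStableAnnihilatorMF

/-!
# The Lean LOST criterion for hypersurface matrix factorisations, end to end — and the first
# kernel-certified loss: `u³ ∉ caᵐ(k[Y,u]/(u⁴Y))` for every `m`

Route `ResolutionOfSingularities/HomologicalConductor`, chain W4.4b (crux `Persistence`
stmt-ResolutionOfSingularities-16484), CHAIN v11.1 §H2L assembly; res-D-pv-026 (self-cut OFFER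
2026-08-27T09:53Z, after U7 = res-D-pv-058 p520525 and U10 = p520008 landed).  [OURS · L1 w44b; AI-written,
weaker than expert review; NOT a statement of the manuscript under study, and no statement of that
manuscript is used.]

* `not_mem_cohomologyAnnihilatorOfDegree_of_not_exists_certificate` — U10b
  (`LostAssembly.not_mem_cohomologyAnnihilatorOfDegree_of_no_certificate`) with its hypothesis `hU7c`
  DISCHARGED by U7c (`PersistenceStableAnnihilatorMF.exists_eq_of_stablyAnnihilates_coker`): for `S`
  noetherian, `f ∈ S⁰`, a matrix factorisation `φψ = f·1 = ψφ` with `det φ ∈ S⁰`, and `x ∈ S` admitting NO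
  certificate `x·1 = Gψ + φE`, the class of `x` lies outside `caᵐ(S ⧸ (f))` for EVERY `m`;
* `not_exists_certificate_u3` — over `S = k[Y,u]` with the rank-one factorisation `(Y)(u⁴) = u⁴Y` there are
  NO `g, e` with `u³ = g·u⁴ + Y·e` (evaluate `Y ↦ 0` and compare degrees in `k[u]`);
* **`u3_not_mem_cohomologyAnnihilatorOfDegree`** — hence `ū³ ∉ caᵐ(B)` for every `m`, `B = k[Y,u]/(u⁴Y)`,
  every field `k`: the `Tor^B`-level loss witness of the LOSS memo (tri-2 K-V8A-CERT §6 (1), stub-2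
  CERT-K-v8a) as a statement about the cohomology annihilator of `B` itself, kernel-certified — the first
  explicit «`x ∉ caᵐ`» in the tree.

References (mechanism only): D. Eisenbud, Trans. AMS 260 (1980) §5–6; S. B. Iyengar, R. Takahashi,
IMRN 2016, §2 [`IyengarTakahashi2014`].
-/

noncomputable section

-- single-problem summit: the doubled namespace component `ResolutionOfSingularities` is forced
set_option linter.dupNamespace false

namespace Summit.ResolutionOfSingularities.ResolutionOfSingularities.Theorems.HomologicalConductor.LostCertificate

open CategoryTheory Literature.RingTheory.CohomologyAnnihilator
open Summit.ResolutionOfSingularities.ResolutionOfSingularities.Theorems.HomologicalConductor.MFCoker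
open Summit.ResolutionOfSingularities.ResolutionOfSingularities.Theorems.NoZeno.SandwichCluster
open Summit.ResolutionOfSingularities.ResolutionOfSingularities.Theorems.HomologicalConductor.LostAssembly
open Summit.ResolutionOfSingularities.ResolutionOfSingularities.Theorems.HomologicalConductor.PersistenceStableAnnihilatorMF
open Matrix

universe u

/-! ## The criterion, end to end -/

section Criterion

variable {S : Type u} [CommRing S]

/-- **The Lean LOST criterion for a hypersurface matrix factorisation** (U10b ∘ U7c): `S` noetherian,
`f ∈ S⁰`, `φψ = f·1 = ψφ`, `det φ ∈ S⁰`; if `x·1 = Gψ + φE` has NO solution `G, E`, then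
`x̄ ∉ caᵐ(S ⧸ (f))` for every `m`. [OURS · L1 w44b] -/
theorem not_mem_cohomologyAnnihilatorOfDegree_of_not_exists_certificate [IsNoetherianRing S] (f : S)
    (hf : f ∈ nonZeroDivisors S) {n : ℕ} (φ ψ : Matrix (Fin n) (Fin n) S)
    (hφψ : φ * ψ = f • (1 : Matrix (Fin n) (Fin n) S)) (hψφ : ψ * φ = f • (1 : Matrix (Fin n) (Fin n) S))
    (hdet : φ.det ∈ nonZeroDivisors S) (x : S)
    (hcert : ¬ ∃ G E : Matrix (Fin n) (Fin n) S, x • (1 : Matrix (Fin n) (Fin n) S) = G * ψ + φ * E)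
    (m : ℕ) :
    Ideal.Quotient.mk (Ideal.span ({f} : Set S)) x ∉
      cohomologyAnnihilatorOfDegree (S ⧸ Ideal.span ({f} : Set S)) m :=
  not_mem_cohomologyAnnihilatorOfDegree_of_no_certificate f hf φ ψ hφψ hψφ hdet x
    (fun h => exists_eq_of_stablyAnnihilates_coker f hf φ ψ hφψ x h) hcert m

end Criterion

/-! ## The first specimen: `u³ ∉ caᵐ(k[Y,u]/(u⁴Y))` -/

section Specimen

variable (k : Type u) [Field k]

/-- `Y = X 0`, `u = X 1` in `k[Y,u] = MvPolynomial (Fin 2) k`; the rank-one matrix factorisation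
`φ = (Y)`, `ψ = (u⁴)` of `f = u⁴·Y`: `φ ψ = f • 1`. [OURS · L1 w44b] -/
theorem phi_mul_psi :
    (!![(MvPolynomial.X 0 : MvPolynomial (Fin 2) k)] : Matrix (Fin 1) (Fin 1) (MvPolynomial (Fin 2) k)) *
        (!![(MvPolynomial.X 1 ^ 4 : MvPolynomial (Fin 2) k)] : Matrix (Fin 1) (Fin 1) (MvPolynomial (Fin 2) k)) =
      (MvPolynomial.X 1 ^ 4 * MvPolynomial.X 0 : MvPolynomial (Fin 2) k) •
        (1 : Matrix (Fin 1) (Fin 1) (MvPolynomial (Fin 2) k)) := by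
  ext i j
  fin_cases i; fin_cases j
  simp [Matrix.mul_apply, mul_comm]

/-- `ψ φ = f • 1`. [OURS · L1 w44b] -/
theorem psi_mul_phi :
    (!![(MvPolynomial.X 1 ^ 4 : MvPolynomial (Fin 2) k)] : Matrix (Fin 1) (Fin 1) (MvPolynomial (Fin 2) k)) *
        (!![(MvPolynomial.X 0 : MvPolynomial (Fin 2) k)] : Matrix (Fin 1) (Fin 1) (MvPolynomial (Fin 2) k)) =
      (MvPolynomial.X 1 ^ 4 * MvPolynomial.X 0 : MvPolynomial (Fin 2) k) •
        (1 : Matrix (Fin 1) (Fin 1) (MvPolynomial (Fin 2) k)) := by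
  ext i j
  fin_cases i; fin_cases j
  simp [Matrix.mul_apply]

/-- `f = u⁴·Y` is a non-zero-divisor of the domain `k[Y,u]`. [OURS · L1 w44b] -/
theorem f_mem_nonZeroDivisors :
    (MvPolynomial.X 1 ^ 4 * MvPolynomial.X 0 : MvPolynomial (Fin 2) k) ∈ nonZeroDivisors (MvPolynomial (Fin 2) k) :=
  mem_nonZeroDivisors_of_ne_zero (mul_ne_zero (pow_ne_zero 4 (MvPolynomial.X_ne_zero 1)) (MvPolynomial.X_ne_zero 0))

/-- `det φ = Y ∈ k[Y,u]⁰`. [OURS · L1 w44b] -/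
theorem det_phi_mem_nonZeroDivisors :
    (!![(MvPolynomial.X 0 : MvPolynomial (Fin 2) k)] : Matrix (Fin 1) (Fin 1) (MvPolynomial (Fin 2) k)).det ∈
      nonZeroDivisors (MvPolynomial (Fin 2) k) := by
  rw [Matrix.det_fin_one_of]
  exact mem_nonZeroDivisors_of_ne_zero (MvPolynomial.X_ne_zero 0)

/-- **No certificate for `u³`**: there are no `g, e ∈ k[Y,u]` with `u³ = g·u⁴ + Y·e` — apply `Y ↦ 0`,
`u ↦ X` (an algebra map to `k[X]`) and compare degrees: `X³ = ḡ·X⁴` is impossible. [OURS · L1 w44b] -/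
theorem not_exists_certificate_u3 :
    ¬ ∃ G E : Matrix (Fin 1) (Fin 1) (MvPolynomial (Fin 2) k),
      (MvPolynomial.X 1 ^ 3 : MvPolynomial (Fin 2) k) • (1 : Matrix (Fin 1) (Fin 1) (MvPolynomial (Fin 2) k)) =
        G * !![MvPolynomial.X 1 ^ 4] + !![MvPolynomial.X 0] * E := by
  rintro ⟨G, E, h⟩
  have h00 := congrArg (fun M : Matrix (Fin 1) (Fin 1) (MvPolynomial (Fin 2) k) => M 0 0) h
  simp only [Matrix.smul_apply, Matrix.one_apply_eq, smul_eq_mul, mul_one, Matrix.add_apply,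
    Matrix.mul_apply, Fin.sum_univ_one, Matrix.of_apply, Matrix.cons_val', Matrix.cons_val_fin_one,
    Matrix.empty_val'] at h00
  -- evaluate `Y ↦ 0`, `u ↦ X`
  let ev : MvPolynomial (Fin 2) k →ₐ[k] Polynomial k := MvPolynomial.aeval ![0, Polynomial.X]
  have hev := congrArg ev h00
  simp only [ev, map_pow, map_add, map_mul, MvPolynomial.aeval_X, Matrix.cons_val_zero, Matrix.cons_val_one,
    zero_mul, add_zero] at hev
  -- `X³ = ev(G₀₀) · X⁴` in `k[X]`: degrees
  have hdvd : (Polynomial.X ^ 4 : Polynomial k) ∣ Polynomial.X ^ 3 := ⟨_, by rw [hev, mul_comm]⟩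
  have h3 : (Polynomial.X ^ 3 : Polynomial k) ≠ 0 := pow_ne_zero 3 Polynomial.X_ne_zero
  have hdeg := Polynomial.natDegree_le_of_dvd hdvd h3
  rw [Polynomial.natDegree_X_pow, Polynomial.natDegree_X_pow] at hdeg
  omega

/-- **FIRST KERNEL-CERTIFIED LOSS**: for every field `k` and every `m`, the class of `u³` does NOT lie in
`caᵐ(B)`, `B = k[Y,u] ⧸ (u⁴·Y)` — the loss witness of the LOSS memo at the level of `B` (odd syzygies of
`B/(Y)` are `B/(Y) = k[u]`-periodic with `u³` acting as `u³ ≠ 0` on `k[u]/(u⁴)`), in cohomology-annihilator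
currency: U10 ∘ U7 with the rank-one factorisation `(Y)(u⁴) = u⁴Y` and `not_exists_certificate_u3`.
[OURS · L1 w44b] -/
theorem u3_not_mem_cohomologyAnnihilatorOfDegree (m : ℕ) :
    Ideal.Quotient.mk (Ideal.span ({MvPolynomial.X 1 ^ 4 * MvPolynomial.X 0} : Set (MvPolynomial (Fin 2) k)))
        (MvPolynomial.X 1 ^ 3) ∉
      cohomologyAnnihilatorOfDegree
        (MvPolynomial (Fin 2) k ⧸ Ideal.span ({MvPolynomial.X 1 ^ 4 * MvPolynomial.X 0} : Set (MvPolynomial (Fin 2) k)))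
        m :=
  not_mem_cohomologyAnnihilatorOfDegree_of_not_exists_certificate (MvPolynomial.X 1 ^ 4 * MvPolynomial.X 0)
    (f_mem_nonZeroDivisors k) !![MvPolynomial.X 0] !![MvPolynomial.X 1 ^ 4] (phi_mul_psi k) (psi_mul_phi k)
    (det_phi_mem_nonZeroDivisors k) (MvPolynomial.X 1 ^ 3) (not_exists_certificate_u3 k) m

end Specimen

end Summit.ResolutionOfSingularities.ResolutionOfSingularities.Theorems.HomologicalConductor.LostCertificate

end
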